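import Summits.Ventures.HodgeRepro2.T6N3Assembly

/-!
# T6N3ToyV — the N3 toy datum on an ARBITRARY automorphic space `L²([G]) = V` (one line through `v`)

Cell pub-hodge-repro2, Tier 6 (README §10), seat t6-p3 (N3 owner, M2). Proof lane; count-neutral.
`T6N3Toy` (p401452) carries the §10.5(ii)(c)/(d) witness of the N3 binder set with `L²([G]) = ℂ`. The
joint instance of the M2 binder set needs the N1 datum's Petersson form on the same `L²([G])`, and
t6-p1's reading of the lead's toy shadow (STATUS l. 11204 (4)(ii)) makes `dim L²([G]) ≥ 6` necessary
there, so `L²([G]) = ℂ` cannot carry a non-degenerate joint instance. This file generalises the toy to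
ANY complete inner product space `V` with a non-zero vector `v`: the theta lift is
`Θ φ f := (φ * conj f) • v`, the lift in the other direction `K_ψ := φ * ⟪ψ, v⟫`, the product of
the vertex forms `F φ_a φ_b := (φ_a * φ_b) • v`, the lift `σ = ℂ ∙ v`, everything else as in `T6N3Toy`
(`L²([H]) = ℂ`, trivial groups, `π₀ = ⊤`, one copy, the toric period `P_χ = id`). Both sides use the
SAME line `ℂ ∙ v` — forced by the interface: `AutSimple` (`σ′_f` irreducible under the trivial
`G(𝔸_f)`) makes every `σ′` one-dimensional, and `N3iso_of_datum` takes `hσ : B.σ = A.σ`. Then ALL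
27 interface Props of T6N3Interface hold, `hypI` / `hypII` hold, `ellNonzero` holds on both sides and
the three N3 statements apply (`toyV_N3A`, `toyV_N3iso`), for every `(V, v)` — `T6N3Toy` is the case
`V = ℂ`, `v = 1`. Nothing here is consumed by the M2 theorem: it is a kernel witness that the N3
binder set is jointly satisfiable on any automorphic space a joint instance may need.

§8(d): uses an L-value-free non-vanishing device: NO.
-/

namespace Summit.Ventures.HodgeRepro2.T6.N3ToyV

open scoped InnerProductSpace
open Summit.Ventures.HodgeRepro2.T6

variable (V : Type) [NormedAddCommGroup V] [InnerProductSpace ℂ V]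

/-! ## 1. The maps `Θ`, `K`, `F` on the line `ℂ ∙ v` -/

/-- The conjugate-linear map `f ↦ (φ * conj f) • v` on `ℂ`, with values in `V`. -/
noncomputable def mulConjSmul (v : V) (φ : ℂ) : ℂ →ₗ⋆[ℂ] V where
  toFun f := (φ * (starRingEnd ℂ) f) • v
  map_add' a b := by simp [mul_add, add_smul]
  map_smul' c a := by simp [smul_smul, mul_left_comm]

/-- `mulConjSmul v φ f = (φ * conj f) • v`. -/
lemma mulConjSmul_apply (v : V) (φ f : ℂ) :
    mulConjSmul V v φ f = (φ * (starRingEnd ℂ) f) • v := rfl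

/-- `φ ↦ (f ↦ (φ * conj f) • v)`, linear in `φ`: the toy theta lift. -/
noncomputable def thetaV (v : V) : ℂ →ₗ[ℂ] (ℂ →ₗ⋆[ℂ] V) where
  toFun φ := mulConjSmul V v φ
  map_add' a b := LinearMap.ext fun f => by simp [mulConjSmul_apply, add_mul, add_smul]
  map_smul' c a := LinearMap.ext fun f => by simp [mulConjSmul_apply, mul_assoc, smul_smul]

/-- `thetaV v φ f = (φ * conj f) • v`. -/
lemma thetaV_apply (v : V) (φ f : ℂ) : thetaV V v φ f = (φ * (starRingEnd ℂ) f) • v := rfl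

/-- The conjugate-linear map `ψ ↦ φ * ⟪ψ, v⟫` on `V`: the toy lift in the other direction. -/
noncomputable def mulInner (v : V) (φ : ℂ) : V →ₗ⋆[ℂ] ℂ where
  toFun ψ := φ * ⟪ψ, v⟫_ℂ
  map_add' a b := by simp [mul_add]
  map_smul' c a := by simp only [inner_smul_left, smul_eq_mul]; ring

/-- `mulInner v φ ψ = φ * ⟪ψ, v⟫`. -/
lemma mulInner_apply (v : V) (φ : ℂ) (ψ : V) : mulInner V v φ ψ = φ * ⟪ψ, v⟫_ℂ := rfl

/-- `φ ↦ (ψ ↦ φ * ⟪ψ, v⟫)`, linear in `φ`. -/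
noncomputable def kliftV (v : V) : ℂ →ₗ[ℂ] (V →ₗ⋆[ℂ] ℂ) where
  toFun φ := mulInner V v φ
  map_add' a b := LinearMap.ext fun ψ => by simp [mulInner_apply, add_mul]
  map_smul' c a := LinearMap.ext fun ψ => by simp [mulInner_apply, mul_assoc]

/-- `kliftV v φ ψ = φ * ⟪ψ, v⟫`. -/
lemma kliftV_apply (v : V) (φ : ℂ) (ψ : V) : kliftV V v φ ψ = φ * ⟪ψ, v⟫_ℂ := rfl

/-- The product of the vertex forms on the toy: `F φ_a φ_b := (φ_a * φ_b) • v`. -/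
noncomputable def prodV (v : V) : ℂ →ₗ[ℂ] ℂ →ₗ[ℂ] V :=
  (LinearMap.mul ℂ ℂ).compr₂ (LinearMap.toSpanSingleton ℂ V v)

/-- `prodV v φa φb = (φa * φb) • v`. -/
lemma prodV_apply (v : V) (φa φb : ℂ) : prodV V v φa φb = (φa * φb) • v := rfl

/-! ## 2. The toy side and the toy datum -/

/-- The toy side on the line `ℂ ∙ v`: `L²([H]) = ℂ`, trivial groups, `Θ = thetaV v`, `K = kliftV v`,
`σ = ℂ ∙ v`, `F = prodV v`. -/
noncomputable abbrev sideV (v : V) : N3Side V Unit where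
  LH := ℂ
  Hf := Unit
  R _ := LinearIsometry.id
  K := ⊤
  Sa := ℂ
  Sb := ℂ
  S := ℂ
  tensor := LinearMap.mul ℂ ℂ
  ωH _ := LinearMap.id
  ωG _ := LinearMap.id
  ωGa _ := LinearMap.id
  ωGb _ := LinearMap.id
  Θ := thetaV V v
  Klift := kliftV V v
  σ := ℂ ∙ v
  π₀ := ⊤
  m₀ := 1
  copy _ := (⊤ : Submodule ℂ ℂ).subtypeₗᵢ
  τ'iso := ⊤
  Cont := ⊤
  Ptor := (⊤ : Submodule ℂ ℂ).subtype
  F := prodV V v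

variable {V}

/-- `Kfix = ⊤` on the toy side (the group is trivial). -/
lemma sideV_Kfix (v : V) : (sideV V v).Kfix = ⊤ :=
  eq_top_iff.mpr fun _ _ _ _ => rfl

/-- `SKfix = ⊤` on the toy side. -/
lemma sideV_SKfix (v : V) : (sideV V v).SKfix = ⊤ :=
  eq_top_iff.mpr fun _ _ _ _ => rfl

/-- `isotypic = ⊤` on the toy side (one copy, the inclusion of `π₀ = ⊤`). -/
lemma sideV_isotypic (v : V) : (sideV V v).isotypic = ⊤ := by
  refine eq_top_iff.mpr fun x _ => ?_
  refine Submodule.mem_iSup_of_mem (0 : Fin 1) ?_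
  exact ⟨⟨x, Submodule.mem_top⟩, rfl⟩

/-- `levelPart = ⊤` on the toy side. -/
lemma sideV_levelPart (v : V) : (sideV V v).levelPart = ⊤ := by
  rw [N3Side.levelPart, sideV_isotypic, sideV_Kfix]
  show ⊤ ⊓ ⊤ ⊓ (⊤ : Submodule ℂ ℂ) = ⊤
  simp

/-! ## 3. Hypotheses (i) / (ii) and the 20 side-level interface Props -/

/-- Hypothesis (i) on the toy: `f = 1`, `φ = 1`, `Θ 1 1 = v ≠ 0`. -/
lemma toyV_hypI {v : V} (hv : v ≠ 0) : (sideV V v).hypI :=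
  ⟨1, ⟨Submodule.mem_top, Submodule.mem_top⟩, 1, by
    show thetaV V v 1 1 ≠ 0
    rw [thetaV_apply]
    simpa using hv⟩

/-- Hypothesis (ii) on the toy: `k = 1 ∈ Π(π₀)^{K,τ′}`, `P_χ(1) = 1 ≠ 0`. -/
lemma toyV_hypII (v : V) : (sideV V v).hypII :=
  ⟨⟨1, Submodule.mem_top⟩, by rw [sideV_levelPart]; exact Submodule.mem_top, one_ne_zero⟩

/-- `KliftCont` on the toy (`Cont = ⊤`). -/
lemma toyV_KliftCont (v : V) : (sideV V v).KliftCont := fun _ _ => Submodule.mem_top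

/-- The seam on the toy: `⟪ψ, (φa φb) • v⟫ = (φa φb) * ⟪ψ, v⟫ = P_χ(K_ψ)`. -/
lemma toyV_Seam (v : V) : (sideV V v).Seam (toyV_KliftCont v) := by
  intro φa φb ψ
  show ⟪ψ, prodV V v φa φb⟫_ℂ = kliftV V v (φa * φb) ψ
  rw [prodV_apply, kliftV_apply, inner_smul_right]

/-- The adjoint identity on the toy: `conj f * (φ * ⟪ψ, v⟫) = (φ * conj f) * ⟪ψ, v⟫`. -/
lemma toyV_Adjoint (v : V) : (sideV V v).Adjoint := by
  intro φ f ψ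
  show ⟪f, kliftV V v φ ψ⟫_ℂ = ⟪ψ, thetaV V v φ f⟫_ℂ
  rw [kliftV_apply, thetaV_apply, inner_smul_right, RCLike.inner_apply]
  ring

/-- `KliftLevel` on the toy. -/
lemma toyV_KliftLevel (v : V) : (sideV V v).KliftLevel :=
  fun _ _ _ => ⟨by rw [sideV_Kfix]; trivial, Submodule.mem_top⟩

/-- `KliftIsotypic` on the toy. -/
lemma toyV_KliftIsotypic (v : V) : (sideV V v).KliftIsotypic := fun _ _ _ _ => by
  rw [sideV_isotypic]; trivial

/-- `ThetaMemSigma` on the toy: `Θ φ f = (φ * conj f) • v ∈ ℂ ∙ v`. -/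
lemma toyV_ThetaMemSigma (v : V) : (sideV V v).ThetaMemSigma := fun φ f _ => by
  show thetaV V v φ f ∈ ℂ ∙ v
  rw [thetaV_apply]
  exact Submodule.smul_mem _ _ (Submodule.mem_span_singleton_self v)

/-- `ThetaTauType ⊤` on the toy. -/
lemma toyV_ThetaTauType (v : V) : (sideV V v).ThetaTauType (⊤ : Submodule ℂ V) :=
  fun _ _ _ => Submodule.mem_top

/-- `CopiesEquivariant` on the toy. -/
lemma toyV_CopiesEquivariant (v : V) : (sideV V v).CopiesEquivariant :=
  fun _ _ _ => ⟨Submodule.mem_top, rfl⟩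

/-- `CopiesOrthogonal` on the toy (one copy). -/
lemma toyV_CopiesOrthogonal (v : V) : (sideV V v).CopiesOrthogonal :=
  fun i j hij => absurd (Subsingleton.elim i j) hij

/-- `CopiesIncl` on the toy. -/
lemma toyV_CopiesIncl (v : V) : (sideV V v).CopiesIncl := ⟨0, fun _ => rfl⟩

/-- `CopiesTauType` on the toy. -/
lemma toyV_CopiesTauType (v : V) : (sideV V v).CopiesTauType := fun _ _ => by simp

/-- `TauTypeDecomposes` on the toy. -/
lemma toyV_TauTypeDecomposes (v : V) : (sideV V v).TauTypeDecomposes :=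
  fun _ _ _ => Submodule.mem_top

/-- `LevelPartFinite` on the toy (`levelPart = ⊤` on `ℂ`). -/
lemma toyV_LevelPartFinite (v : V) : (sideV V v).LevelPartFinite := by
  show FiniteDimensional ℂ (sideV V v).levelPart
  rw [sideV_levelPart]
  infer_instance

/-- `LevelPartCont` on the toy. -/
lemma toyV_LevelPartCont (v : V) : (sideV V v).LevelPartCont := fun _ _ => Submodule.mem_top

/-- `KAverage` on the toy (`φ' = φ`). -/
lemma toyV_KAverage (v : V) : (sideV V v).KAverage :=
  fun φ => ⟨φ, by rw [sideV_SKfix]; trivial, fun _ _ => rfl⟩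

/-- `ThetaEquivariant` on the toy (the group is trivial). -/
lemma toyV_ThetaEquivariant (v : V) : (sideV V v).ThetaEquivariant := fun _ _ _ => rfl

/-- `SpanOfFixedVector` on the toy: every `w ∈ ℂ` is a multiple of a non-zero `u`. -/
lemma toyV_SpanOfFixedVector (v : V) : (sideV V v).SpanOfFixedVector := by
  intro j u hu hu0 w _
  have hmem : u ∈ Submodule.span ℂ (Set.range fun g : Unit => (sideV V v).R g u) :=
    Submodule.subset_span ⟨(), rfl⟩
  have : (w / u) • u = w := by
    rw [smul_eq_mul, div_mul_cancel₀ w hu0]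
  rw [← this]
  exact Submodule.smul_mem _ _ hmem

/-- `CrossCopyOrthogonal` on the toy (one copy). -/
lemma toyV_CrossCopyOrthogonal (v : V) : (sideV V v).CrossCopyOrthogonal :=
  fun i j hij => absurd (Subsingleton.elim i j) hij

/-- `CopyIndependence` on the toy (one copy). -/
lemma toyV_CopyIndependence (v : V) : (sideV V v).CopyIndependence := fun i j _ _ _ _ => by
  rw [Subsingleton.elim i j]

/-- `TensorsSpan` on the toy (`x = x * 1`). -/
lemma toyV_TensorsSpan (v : V) : (sideV V v).TensorsSpan := by
  intro x _
  have : x ∈ Set.range fun p : ℂ × ℂ => (sideV V v).tensor p.1 p.2 := ⟨(x, 1), by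
    show x * 1 = x
    exact mul_one x⟩
  exact Submodule.subset_span this

/-! ## 4. The toy datum on `V` (complete), the datum-level interface Props and the assembly -/

variable [CompleteSpace V]

variable (V) in
/-- The toy datum on `V`: `L²([G]) = V`, the trivial group, one automorphic representation `ℂ ∙ v`,
both sides the toy side on the same line. -/
noncomputable abbrev toyV (v : V) : N3Datum where
  LG := V
  Gf := Unit
  ρ _ := LinearIsometry.id
  τiso := ⊤
  Aut := Unit
  aut _ := ℂ ∙ v
  A := sideV V v
  B := sideV V v

/-- (d) for side A / side B: `ellNonzero` on the toy from the three N3 statements. -/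
theorem toyV_N3A {v : V} (hv : v ≠ 0) : (toyV V v).ellNonzero (toyV V v).A :=
  (toyV V v).N3A_of_datum (toyV_KliftCont v) (toyV_Seam v) (toyV_Adjoint v) (toyV_KliftLevel v)
    (toyV_KliftIsotypic v) (toyV_ThetaMemSigma v) (toyV_ThetaTauType v) (toyV_CopiesEquivariant v)
    (toyV_CopiesOrthogonal v) (toyV_CopiesIncl v) (toyV_CopiesTauType v) (toyV_TauTypeDecomposes v)
    (toyV_LevelPartFinite v) (toyV_LevelPartCont v) (toyV_KAverage v) (toyV_ThetaEquivariant v)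
    (toyV_SpanOfFixedVector v) (toyV_CrossCopyOrthogonal v) (toyV_CopyIndependence v)
    (toyV_TensorsSpan v) (toyV_hypI hv) (toyV_hypII v)

/-- `ProductsIn20` on the toy: every product `(φa φb) • v` lies in `ℂ ∙ v ⊓ ⊤`. -/
lemma toyV_ProductsIn20 (v : V) : (toyV V v).ProductsIn20 (toyV V v).A := by
  refine Submodule.span_le.mpr ?_
  rintro _ ⟨p, rfl⟩
  show prodV V v p.1 p.2 ∈ ⨆ i : Unit, (ℂ ∙ v) ⊓ (⊤ : Submodule ℂ V)
  refine Submodule.mem_iSup_of_mem () ⟨?_, Submodule.mem_top⟩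
  rw [prodV_apply]
  exact Submodule.smul_mem _ _ (Submodule.mem_span_singleton_self v)

/-- `ProductEquivariant` on the toy (trivial group). -/
lemma toyV_ProductEquivariant (v : V) : (toyV V v).ProductEquivariant (toyV V v).A :=
  fun _ _ _ => rfl

/-- `AutStable` on the toy (`ρ = id`). -/
lemma toyV_AutStable (v : V) : (toyV V v).AutStable := fun _ _ _ hx => hx

/-- `AutSimple` on the toy: a subspace of the line `ℂ ∙ v` is `⊥` or the line. -/
lemma toyV_AutSimple (v : V) : (toyV V v).AutSimple := by
  intro i N hN _
  have hN' : N ≤ ℂ ∙ v := by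
    refine hN.trans ?_
    show (ℂ ∙ v) ⊓ (⊤ : Submodule ℂ V) ≤ ℂ ∙ v
    exact inf_le_left
  by_cases hbot : N = ⊥
  · exact Or.inl hbot
  · right
    obtain ⟨x, hxN, hx0⟩ := Submodule.exists_mem_ne_zero_of_ne_bot hbot
    obtain ⟨c, rfl⟩ := Submodule.mem_span_singleton.mp (hN' hxN)
    have hc : c ≠ 0 := fun h => hx0 (by rw [h, zero_smul])
    have hv : v ∈ N := by
      have := N.smul_mem c⁻¹ hxN
      rwa [smul_smul, inv_mul_cancel₀ hc, one_smul] at this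
    refine le_antisymm hN ?_
    show (ℂ ∙ v) ⊓ (⊤ : Submodule ℂ V) ≤ N
    exact inf_le_left.trans ((Submodule.span_singleton_le_iff_mem v N).mpr hv)

/-- `AutNonIso` on the toy (one automorphic representation). -/
lemma toyV_AutNonIso (v : V) : (toyV V v).AutNonIso (toyV_AutStable v) :=
  fun i j hij => absurd (Subsingleton.elim i j) hij

/-- `AutOrthogonal` on the toy (one automorphic representation). -/
lemma toyV_AutOrthogonal (v : V) : (toyV V v).AutOrthogonal :=
  fun i j hij => absurd (Subsingleton.elim i j) hij

/-- `SigmaIsAut` on the toy: the lift `σ = ℂ ∙ v` is the automorphic representation. -/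
lemma toyV_SigmaIsAut (v : V) : (toyV V v).SigmaIsAut (toyV V v).A := ⟨(), rfl⟩

/-- (d) for the assembly: a single pair of products with a non-zero pairing on the toy over `V`. -/
theorem toyV_N3iso {v : V} (hv : v ≠ 0) :
    ∃ (φa : (toyV V v).A.Sa) (φb : (toyV V v).A.Sb) (φc : (toyV V v).B.Sa) (φd : (toyV V v).B.Sb),
      ⟪(toyV V v).B.F φc φd, (toyV V v).A.F φa φb⟫_ℂ ≠ 0 :=
  (toyV V v).N3iso_of_datum (toyV_AutOrthogonal v) (toyV_AutStable v) (toyV_AutSimple v)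
    (toyV_AutNonIso v) (toyV_ProductsIn20 v) (toyV_ProductEquivariant v) (toyV_ProductsIn20 v)
    (toyV_ProductEquivariant v) (toyV_SigmaIsAut v) rfl (toyV_N3A hv) (toyV_N3A hv)

/-- The pairing of the unit products on the toy is `‖v‖²`: the explicit witness behind `toyV_N3iso`. -/
lemma toyV_pairing_one (v : V) :
    ⟪(toyV V v).B.F 1 1, (toyV V v).A.F 1 1⟫_ℂ = (‖v‖ ^ 2 : ℝ) := by
  show ⟪prodV V v 1 1, prodV V v 1 1⟫_ℂ = (‖v‖ ^ 2 : ℝ)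
  rw [prodV_apply, one_mul, one_smul, inner_self_eq_norm_sq_to_K]
  norm_cast

end Summit.Ventures.HodgeRepro2.T6.N3ToyV
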